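import Mathlib
import HarnessLib
import Summits.HubbardSuperconductivity.HubbardSuperconductivity.Theorems.KLProgrammeFermiSurfaceFST2

/-!
# Route `KLProgramme` (cruxes K3/K1): FST II hypotheses (A1), (A2), (A3), as TYPED in
# `FermiRG/FST2Hypotheses.lean`, for the Hubbard band — regularity, `∇e ≠ 0`, and the curvature form

Cell `gate-hubbard-kl`, risk-register item r2; continues `KLProgrammeFermiSurfaceFST2.lean` ((Sy), (A4), (A5) iff
`μ < -2`). With `e = fun p ↦ squareDispersion 1 0 p - μ` on `FermiRG.Crystal.cubic 2` we PROVE: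

* (A1)_{k,0} for the on-site interaction `v̂ ≡ U` (`klfs_hypA1`): a real constant is periodic, `C^{k,0}`,
  satisfies (evenv), and is its own `p₀ → ∞` limit with zero remainder;
* (A2)_{k,0} for every `k` and every level `-4 < μ < 0` (`klfs_hypA2`): `e` is `2πℤ²`-periodic
  (`klfs_isLatticePeriodic_e`), smooth with all derivatives bounded (`klfs_memContDiffHolder_e`, via the
  general `klfs_memContDiffHolder_of_periodic`: continuous + periodic ⇒ bounded on the compact cell), and
  `∇e ≠ 0` on the whole level set (`klfs_gradient_e_ne_zero`, quantitatively `‖∇e‖ ≥ √(-μ(4+μ))` from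
  `KLProgrammeFermiSurfaceEnvelope`);
* (A3) for every level `-4 < μ < 0` (`klfs_hypA3`): the Hessian form is computed in closed form,
  `hessQuad e p v = (v, e''(p) v) = 2 (cos p₀ v₀² + cos p₁ v₁²)` (`klfs_iteratedFDeriv_two_e`,
  `klfs_hessQuad_e`), and on tangent vectors `v ⊥ ∇e(p)` one has
  `S · (cos p₀ v₀² + cos p₁ v₁²) = N · |v|²` with `S = sin² p₀ + sin² p₁ > 0` and the curvature numerator
  `N = cos p₀ sin² p₁ + cos p₁ sin² p₀ > 0` (`klfs_curvature_num_pos`) — strict convexity in FST's sense.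

So, for the Hubbard band on the Kohn–Luttinger window, (A1)–(A4) HOLD and (A5) FAILS (previous file):
the umklapp-corner lemma (crux C4b) is load-bearing. No definitions; everything PROVED. [folklore]
-/

noncomputable section

open Real Set

-- the tree's namespace `Summit.<Summit>.<Problem>.Theorems` repeats the summit name by design (D-0017)
set_option linter.dupNamespace false

namespace Summit.HubbardSuperconductivity.HubbardSuperconductivity.Theorems

open Literature.MathematicalPhysics.QuantumLattice

/-! ### §4 (A1)–(A3): regularity of the interaction and of the band, with the curvature form -/

section Regularity

open Literature.Analysis.FunctionSpaces

/-- A `C^k` function on momentum space that is `2πℤ²`-periodic lies in `C^{k,0}_b`: all derivatives of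
order `≤ k` are bounded (they are continuous and periodic, so bounded by their maximum over the compact
cell `[-π, π]²`) and `D^k f` has bounded oscillation (`0`-Hölder). [folklore] -/
theorem klfs_memContDiffHolder_of_periodic {f : Momentum → ℝ} {k : ℕ} (hf : ContDiff ℝ k f)
    (hper : ∀ (n : Fin 2 → ℤ) (x : Momentum), f (x + WithLp.toLp 2 (fun i => (n i : ℝ) * (2 * π))) = f x) :
    MemContDiffHolder k 0 f := by
  -- every derivative of order `j ≤ k` is bounded
  have hbound : ∀ j ≤ k, ∃ C : ℝ, ∀ x, ‖iteratedFDeriv ℝ j f x‖ ≤ C := by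
    intro j hj
    set g := iteratedFDeriv ℝ j f with hg
    have hgc : Continuous g := hf.continuous_iteratedFDeriv (by exact_mod_cast hj)
    set K : Set Momentum := (fun y : Fin 2 → ℝ => WithLp.toLp 2 y) '' Set.pi univ (fun _ => Icc (-π) π) with hK
    have hKc : IsCompact K := (isCompact_univ_pi fun _ => isCompact_Icc).image (PiLp.continuous_toLp 2 _)
    obtain ⟨C, hC⟩ := hKc.exists_bound_of_continuousOn hgc.continuousOn
    refine ⟨C, fun x => ?_⟩
    -- reduce `x` into the cell by a lattice vector
    choose n hn using fun i => BandSectorCounting.exists_int_abs_sub_le_pi (x i)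
    set a : Momentum := WithLp.toLp 2 (fun i => ((-n i : ℤ) : ℝ) * (2 * π)) with ha
    have hz : x + a ∈ K := by
      refine ⟨fun i => x i - n i * (2 * π), fun i _ => ?_, ?_⟩
      · have h := abs_le.1 (hn i); exact ⟨by linarith [h.1], by linarith [h.2]⟩
      · ext i; simp [ha]; ring
    have hshift : g x = g (x + a) := by
      have hfun : (fun y => f (y + a)) = f := funext fun y => hper (fun i => -n i) y
      have h1 := iteratedFDeriv_comp_add_right (𝕜 := ℝ) (f := f) j a x
      rw [hfun] at h1
      rw [hg, h1]
    rw [hshift]; exact hC _ hz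
  refine ⟨hf, fun j hj => eSupNorm_lt_top_iff.2 (hbound j hj), ?_⟩
  obtain ⟨C, hC⟩ := hbound k le_rfl
  refine ⟨Real.toNNReal (2 * C), fun x y => ?_⟩
  rw [NNReal.coe_zero, ENNReal.rpow_zero, mul_one, edist_dist, ENNReal.ofReal]
  exact ENNReal.coe_le_coe.2 (Real.toNNReal_le_toNNReal
    ((dist_le_norm_add_norm _ _).trans (by linarith [hC x, hC y])))

/-- The coordinate projections of momentum space as continuous linear maps (plumbing). [folklore] -/
theorem klfs_proj_apply (i : Fin 2) (q : Momentum) :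
    (PiLp.proj 2 (fun _ : Fin 2 => ℝ) i : Momentum →L[ℝ] ℝ) q = q i := rfl

/-- `e = ε - μ` through the coordinate projections: `e = -2 (cos ∘ P₀ + cos ∘ P₁) - μ`. [folklore] -/
theorem klfs_e_eq_comp_proj (μ : ℝ) :
    (fun q : Momentum => squareDispersion 1 0 q - μ) = fun q : Momentum =>
      -2 * (Real.cos ((PiLp.proj 2 (fun _ : Fin 2 => ℝ) 0 : Momentum →L[ℝ] ℝ) q) +
        Real.cos ((PiLp.proj 2 (fun _ : Fin 2 => ℝ) 1 : Momentum →L[ℝ] ℝ) q)) - μ := by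
  funext q; simp [squareDispersion]

/-- **`e = ε - μ` is smooth** (`C^k` for every `k`). [folklore] -/
theorem klfs_contDiff_e (μ : ℝ) {n : WithTop ℕ∞} : ContDiff ℝ n (fun q : Momentum => squareDispersion 1 0 q - μ) := by
  rw [klfs_e_eq_comp_proj]
  exact (contDiff_const.mul ((Real.contDiff_cos.comp (ContinuousLinearMap.contDiff _)).add
    (Real.contDiff_cos.comp (ContinuousLinearMap.contDiff _)))).sub contDiff_const

/-- `e` is `2πℤ²`-periodic coordinatewise. [folklore] -/
theorem klfs_e_periodic (μ : ℝ) (n : Fin 2 → ℤ) (x : Momentum) :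
    squareDispersion 1 0 (x + WithLp.toLp 2 (fun i => (n i : ℝ) * (2 * π))) - μ = squareDispersion 1 0 x - μ := by
  simp [squareDispersion, Real.cos_add_int_mul_two_pi]

/-- **`e ∈ C^{k,0}_b` for every `k`** (smooth and periodic). [folklore] -/
theorem klfs_memContDiffHolder_e (μ : ℝ) (k : ℕ) :
    MemContDiffHolder k 0 (fun q : Momentum => squareDispersion 1 0 q - μ) :=
  klfs_memContDiffHolder_of_periodic (klfs_contDiff_e μ) (fun n x => klfs_e_periodic μ n x)

/-- `2π eᵢ`: the generators of `Γ# = 2πℤ²`. [folklore] -/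
theorem klfs_cubicBasis_apply (i : Fin 2) :
    FermiRG.Crystal.cubicBasis 2 i = (2 * π) • EuclideanSpace.basisFun (Fin 2) ℝ i := by
  simp [FermiRG.Crystal.cubicBasis, Module.Basis.isUnitSMul_apply]

/-- **`e` is a function on the torus `ℝ²/2πℤ²`**: periodic under the dual lattice of `Crystal.cubic 2`. [folklore] -/
theorem klfs_isLatticePeriodic_e (μ : ℝ) :
    FermiRG.IsLatticePeriodic (FermiRG.Crystal.cubic 2).dualLattice (fun q : Momentum => squareDispersion 1 0 q - μ) := by
  intro γ hγ
  change γ ∈ Submodule.span ℤ (Set.range (FermiRG.Crystal.cubicBasis 2)) at hγ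
  induction hγ using Submodule.span_induction with
  | mem x hx =>
      obtain ⟨i, rfl⟩ := hx
      intro p
      rw [klfs_cubicBasis_apply]
      fin_cases i <;>
        simp [squareDispersion, EuclideanSpace.basisFun_apply, Real.cos_add_two_pi]
  | zero => intro p; simp
  | add x y _ _ hx hy => intro p; rw [← add_assoc, hy, hx]
  | smul a x _ hx =>
      induction a using Int.induction_on with
      | zero => intro p; simp
      | succ i ih => intro p; rw [add_zsmul, one_zsmul, ← add_assoc, hx, ih]
      | pred i ih =>
          intro p
          have h := hx (p + (-(i : ℤ) - 1) • x)
          rw [add_assoc, show (-(i : ℤ) - 1) • x + x = (-(i : ℤ)) • x by rw [sub_zsmul, one_zsmul]; abel] at h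
          rw [← h, ih]

/-- **`∇e ≠ 0` on the whole Fermi surface** `{ε = μ}` (no fundamental-domain restriction), `-4 < μ < 0`:
`‖∇e‖² = 4 (sin² p₀ + sin² p₁) ≥ -μ (4 + μ) > 0`. [folklore] -/
theorem klfs_gradient_e_ne_zero {μ : ℝ} (hμ₁ : -4 < μ) (hμ₂ : μ < 0) {p : Momentum}
    (hp : p ∈ FermiRG.fermiSurface (fun q : Momentum => squareDispersion 1 0 q - μ)) :
    gradient (fun q : Momentum => squareDispersion 1 0 q - μ) p ≠ 0 := by
  rw [klfs_gradient_level]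
  have he : -2 * (Real.cos (p 0) + Real.cos (p 1)) = μ := by
    have := klfs_mem_fermiSurface_iff.1 hp; simp [squareDispersion] at this; linarith
  have hI := (klfs_fermiSpeedSq_mem_Icc he).1
  have hpos : 0 < -μ * (4 + μ) := by nlinarith
  intro h0
  have hn := norm_gradient_squareDispersion p
  rw [h0, norm_zero] at hn
  have hs : Real.sqrt (Real.sin (p 0) ^ 2 + Real.sin (p 1) ^ 2) = 0 := by linarith
  rw [Real.sqrt_eq_zero (by positivity)] at hs
  linarith

/-- **(A2)_{k,0} for the Hubbard band**, every `k` and every level `-4 < μ < 0`: `e ∈ C^{k,0}(𝓑, ℝ)` and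
`∇e ≠ 0` on `S` (quantitatively `‖∇e‖ ≥ √(-μ (4 + μ))`, `klfs_sqrt_le_norm_gradient`). [folklore] -/
theorem klfs_hypA2 {μ : ℝ} (hμ₁ : -4 < μ) (hμ₂ : μ < 0) (k : ℕ) :
    FermiRG.HypA2 (FermiRG.Crystal.cubic 2) k 0 (fun q : Momentum => squareDispersion 1 0 q - μ) where
  periodic := klfs_isLatticePeriodic_e μ
  memContDiffHolder := klfs_memContDiffHolder_e μ k
  gradient_ne_zero := fun _ hp => klfs_gradient_e_ne_zero hμ₁ hμ₂ hp

/-- The derivative of `e`: `De(z) = 2 sin z₀ · P₀ + 2 sin z₁ · P₁`. [folklore] -/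
theorem klfs_hasFDerivAt_e (μ : ℝ) (z : Momentum) :
    HasFDerivAt (fun q : Momentum => squareDispersion 1 0 q - μ)
      ((2 * Real.sin (z 0)) • (PiLp.proj 2 (fun _ : Fin 2 => ℝ) 0 : Momentum →L[ℝ] ℝ) +
        (2 * Real.sin (z 1)) • (PiLp.proj 2 (fun _ : Fin 2 => ℝ) 1 : Momentum →L[ℝ] ℝ)) z := by
  set P0 : Momentum →L[ℝ] ℝ := PiLp.proj 2 (fun _ : Fin 2 => ℝ) 0 with hP0
  set P1 : Momentum →L[ℝ] ℝ := PiLp.proj 2 (fun _ : Fin 2 => ℝ) 1 with hP1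
  have h0 : HasFDerivAt (fun q : Momentum => Real.cos (P0 q)) (-Real.sin (P0 z) • P0) z :=
    (Real.hasDerivAt_cos (P0 z)).comp_hasFDerivAt z P0.hasFDerivAt
  have h1 : HasFDerivAt (fun q : Momentum => Real.cos (P1 q)) (-Real.sin (P1 z) • P1) z :=
    (Real.hasDerivAt_cos (P1 z)).comp_hasFDerivAt z P1.hasFDerivAt
  have h := ((h0.add h1).const_mul (-2 : ℝ)).sub_const μ
  rw [klfs_e_eq_comp_proj]
  refine h.congr_fderiv ?_
  ext q
  simp [hP0, hP1]
  ring

/-- `fderiv e = De`. [folklore] -/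
theorem klfs_fderiv_e (μ : ℝ) :
    fderiv ℝ (fun q : Momentum => squareDispersion 1 0 q - μ) = fun z : Momentum =>
      (2 * Real.sin (z 0)) • (PiLp.proj 2 (fun _ : Fin 2 => ℝ) 0 : Momentum →L[ℝ] ℝ) +
        (2 * Real.sin (z 1)) • (PiLp.proj 2 (fun _ : Fin 2 => ℝ) 1 : Momentum →L[ℝ] ℝ) :=
  funext fun z => (klfs_hasFDerivAt_e μ z).fderiv

/-- The second derivative of `e`: `D²e(z) = 2 cos z₀ · P₀ ⊗ P₀ + 2 cos z₁ · P₁ ⊗ P₁`. [folklore] -/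
theorem klfs_hasFDerivAt_fderiv_e (μ : ℝ) (z : Momentum) :
    HasFDerivAt (fderiv ℝ (fun q : Momentum => squareDispersion 1 0 q - μ))
      (((2 * Real.cos (z 0)) • (PiLp.proj 2 (fun _ : Fin 2 => ℝ) 0 : Momentum →L[ℝ] ℝ)).smulRight
          (PiLp.proj 2 (fun _ : Fin 2 => ℝ) 0 : Momentum →L[ℝ] ℝ) +
        ((2 * Real.cos (z 1)) • (PiLp.proj 2 (fun _ : Fin 2 => ℝ) 1 : Momentum →L[ℝ] ℝ)).smulRight
          (PiLp.proj 2 (fun _ : Fin 2 => ℝ) 1 : Momentum →L[ℝ] ℝ)) z := by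
  set P0 : Momentum →L[ℝ] ℝ := PiLp.proj 2 (fun _ : Fin 2 => ℝ) 0 with hP0
  set P1 : Momentum →L[ℝ] ℝ := PiLp.proj 2 (fun _ : Fin 2 => ℝ) 1 with hP1
  rw [klfs_fderiv_e]
  have hs0 : HasFDerivAt (fun q : Momentum => 2 * Real.sin (P0 q)) ((2 * Real.cos (z 0)) • P0) z := by
    have h := ((Real.hasDerivAt_sin (P0 z)).comp_hasFDerivAt z P0.hasFDerivAt).const_mul (2 : ℝ)
    refine h.congr_fderiv ?_
    rw [smul_smul]; rfl
  have hs1 : HasFDerivAt (fun q : Momentum => 2 * Real.sin (P1 q)) ((2 * Real.cos (z 1)) • P1) z := by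
    have h := ((Real.hasDerivAt_sin (P1 z)).comp_hasFDerivAt z P1.hasFDerivAt).const_mul (2 : ℝ)
    refine h.congr_fderiv ?_
    rw [smul_smul]; rfl
  exact (hs0.smul_const P0).add (hs1.smul_const P1)

/-- **The Hessian form of `e`**: `(v, e''(p) w) = 2 cos p₀ · v₀ w₀ + 2 cos p₁ · v₁ w₁`
(`iteratedFDeriv ℝ 2`). [folklore] -/
theorem klfs_iteratedFDeriv_two_e (μ : ℝ) (p v w : Momentum) :
    iteratedFDeriv ℝ 2 (fun q : Momentum => squareDispersion 1 0 q - μ) p ![v, w] =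
      2 * Real.cos (p 0) * v 0 * w 0 + 2 * Real.cos (p 1) * v 1 * w 1 := by
  rw [iteratedFDeriv_two_apply, (klfs_hasFDerivAt_fderiv_e μ p).fderiv]
  simp

/-- **FST's quadratic form `hessQuad e p v = 2 (cos p₀ v₀² + cos p₁ v₁²)`** for the Hubbard band. [folklore] -/
theorem klfs_hessQuad_e (μ : ℝ) (p v : Momentum) :
    FermiRG.hessQuad (fun q : Momentum => squareDispersion 1 0 q - μ) p v =
      2 * (Real.cos (p 0) * v 0 ^ 2 + Real.cos (p 1) * v 1 ^ 2) := by
  rw [FermiRG.hessQuad, klfs_iteratedFDeriv_two_e]; ring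

/-- The tangency condition in coordinates: `⟪∇e(p), v⟫ = 2 (sin p₀ v₀ + sin p₁ v₁)`. [folklore] -/
theorem klfs_inner_gradient_e (μ : ℝ) (p v : Momentum) :
    inner ℝ (gradient (fun q : Momentum => squareDispersion 1 0 q - μ) p) v =
      2 * (Real.sin (p 0) * v 0 + Real.sin (p 1) * v 1) := by
  rw [klfs_gradient_level, gradient_squareDispersion, PiLp.inner_apply, Fin.sum_univ_two]
  simp
  ring

/-- **(A3) for the Hubbard band** at every level `-4 < μ < 0`: on the Fermi surface the Hessian form is
strictly positive on non-zero tangent vectors — for `v ⊥ ∇e(p)`,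
`S · (cos p₀ v₀² + cos p₁ v₁²) = N · |v|²` with `S = sin² p₀ + sin² p₁ > 0` and the curvature numerator
`N = cos p₀ sin² p₁ + cos p₁ sin² p₀ > 0` (`klfs_curvature_num_pos`); quantitatively
`(v, e'' v) ≥ (-μ/√(32 - 2μ²)) · √(-μ(4 + μ)) · |v|²` by the envelopes of `KLProgrammeFermiSurfaceEnvelope`.
[folklore] -/
theorem klfs_hypA3 {μ : ℝ} (hμ₁ : -4 < μ) (hμ₂ : μ < 0) :
    FermiRG.HypA3 (fun q : Momentum => squareDispersion 1 0 q - μ) := by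
  intro p hp v hv hinner
  rw [klfs_hessQuad_e]
  rw [klfs_inner_gradient_e] at hinner
  have he : -2 * (Real.cos (p 0) + Real.cos (p 1)) = μ := by
    have := klfs_mem_fermiSurface_iff.1 hp; simp [squareDispersion] at this; linarith
  have hN := klfs_curvature_num_pos hμ₁ hμ₂ he
  have hS : 0 < Real.sin (p 0) ^ 2 + Real.sin (p 1) ^ 2 := by
    have hI := (klfs_fermiSpeedSq_mem_Icc he).1; nlinarith
  have hv2 : 0 < v 0 ^ 2 + v 1 ^ 2 := by
    by_contra hle
    push Not at hle
    have h0 : v 0 = 0 := by nlinarith [sq_nonneg (v 0), sq_nonneg (v 1)]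
    have h1 : v 1 = 0 := by nlinarith [sq_nonneg (v 0), sq_nonneg (v 1)]
    exact hv (by ext i; fin_cases i <;> simp [h0, h1])
  have htan : Real.sin (p 0) * v 0 + Real.sin (p 1) * v 1 = 0 := by linarith
  have key : (Real.sin (p 0) ^ 2 + Real.sin (p 1) ^ 2) * (Real.cos (p 0) * v 0 ^ 2 + Real.cos (p 1) * v 1 ^ 2) =
      (Real.cos (p 0) * Real.sin (p 1) ^ 2 + Real.cos (p 1) * Real.sin (p 0) ^ 2) * (v 0 ^ 2 + v 1 ^ 2) := by
    linear_combination (Real.cos (p 0) - Real.cos (p 1)) * (Real.sin (p 0) * v 0 - Real.sin (p 1) * v 1) * htan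
  nlinarith [mul_pos hN hv2, key]

/-- **The curvature constant of (A3), closed form**: on the level set `ε = μ` (`-4 < μ < 0`), for every
tangent vector `v ⊥ ∇e(p)`, `(v, e''(p) v) ≥ (-μ/2) |v|²` — equality at the node; this is FST's `w`-constant
(Lemma 2.1, `w ≥ w_min`) for the Hubbard band, uniformly `≥ 0.0899 |v|²` on the certified window. [folklore] -/
theorem klfs_hessQuad_tangent_ge {μ : ℝ} (hμ₁ : -4 < μ) (hμ₂ : μ < 0) {p : Momentum}
    (hp : p ∈ FermiRG.fermiSurface (fun q : Momentum => squareDispersion 1 0 q - μ)) {v : Momentum}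
    (hinner : inner ℝ (gradient (fun q : Momentum => squareDispersion 1 0 q - μ) p) v = 0) :
    (-μ / 2) * (v 0 ^ 2 + v 1 ^ 2) ≤ FermiRG.hessQuad (fun q : Momentum => squareDispersion 1 0 q - μ) p v := by
  rw [klfs_hessQuad_e]
  rw [klfs_inner_gradient_e] at hinner
  have he : -2 * (Real.cos (p 0) + Real.cos (p 1)) = μ := by
    have := klfs_mem_fermiSurface_iff.1 hp; simp [squareDispersion] at this; linarith
  have hlev : Real.cos (p 0) + Real.cos (p 1) = -μ / 2 := by linarith
  have hS : 0 < Real.sin (p 0) ^ 2 + Real.sin (p 1) ^ 2 := by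
    have hI := (klfs_fermiSpeedSq_mem_Icc he).1; nlinarith
  have hS1 : Real.sin (p 0) ^ 2 + Real.sin (p 1) ^ 2 ≤ 2 - (-μ / 2) ^ 2 / 2 := by
    rw [Real.sin_sq, Real.sin_sq]; exact klfs_level_S_le hlev
  have hN : Real.cos (p 0) * Real.sin (p 1) ^ 2 + Real.cos (p 1) * Real.sin (p 0) ^ 2 =
      (-μ / 2) * (4 - (-μ / 2) ^ 2 - (Real.sin (p 0) ^ 2 + Real.sin (p 1) ^ 2)) / 2 := by
    rw [Real.sin_sq, Real.sin_sq, klfs_level_N_eq hlev]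
  have htan : Real.sin (p 0) * v 0 + Real.sin (p 1) * v 1 = 0 := by linarith
  have key : (Real.sin (p 0) ^ 2 + Real.sin (p 1) ^ 2) * (Real.cos (p 0) * v 0 ^ 2 + Real.cos (p 1) * v 1 ^ 2) =
      (Real.cos (p 0) * Real.sin (p 1) ^ 2 + Real.cos (p 1) * Real.sin (p 0) ^ 2) * (v 0 ^ 2 + v 1 ^ 2) := by
    linear_combination (Real.cos (p 0) - Real.cos (p 1)) * (Real.sin (p 0) * v 0 - Real.sin (p 1) * v 1) * htan
  -- `S · Q = N · V` with `2N - m S = m (4 - m² - 2S) ≥ 0`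
  have hv2 : 0 ≤ v 0 ^ 2 + v 1 ^ 2 := by positivity
  have hm : 0 < -μ / 2 := by linarith
  nlinarith [key, hN, mul_nonneg (mul_nonneg hm.le (sub_nonneg.2 hS1)) hv2]

/-- **(A1)_{k,0} for the on-site Hubbard interaction** `v̂ ≡ U` (instantaneous and momentum-independent):
constant functions are periodic, `C^{k,0}`, real (so (evenv) holds), equal to their own `p₀ → ∞` limit
`ṽ = U` with zero decay remainder. [folklore] -/
theorem klfs_hypA1 (U : ℝ) (k : ℕ) :
    FermiRG.HypA1 (FermiRG.Crystal.cubic 2) k 0 (fun _ : ℝ × Momentum => (U : ℂ)) := by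
  have hconst : ∀ {X : Type} [NormedAddCommGroup X] [NormedSpace ℝ X] {Y : Type} [NormedAddCommGroup Y]
      [NormedSpace ℝ Y] (c : Y), MemContDiffHolder k 0 (fun _ : X => c) := by
    intro X _ _ Y _ _ c
    have hshift : ∀ j (x y : X), iteratedFDeriv ℝ j (fun _ : X => c) x = iteratedFDeriv ℝ j (fun _ : X => c) y := by
      intro j x y
      have h := iteratedFDeriv_comp_add_right (𝕜 := ℝ) (f := fun _ : X => c) j (y - x) x
      simpa using h
    refine ⟨contDiff_const, fun j _ => eSupNorm_lt_top_iff.2 ⟨‖iteratedFDeriv ℝ j (fun _ : X => c) 0‖,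
      fun x => le_of_eq (by rw [hshift j x 0])⟩, ⟨1, fun x y => ?_⟩⟩
    rw [hshift k x y, edist_self]; exact bot_le
  refine ⟨fun _ _ _ _ => rfl, hconst (U : ℂ), fun _ _ => by simp, ⟨fun _ => U, hconst U,
    fun _ => tendsto_const_nhds, 1, 1, 1, one_pos, one_pos, one_pos, fun p₀ _ _ => ?_⟩⟩
  simp only [sub_self, norm_zero]
  positivity

end Regularity

end Summit.HubbardSuperconductivity.HubbardSuperconductivity.Theorems

end
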